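import Mathlib.Combinatorics.SetFamily.FourFunctions
import Mathlib.Tactic
import HarnessLib
import HarnessLib.Audit.Tags

/-!
# Equality in the Marica–Schönheim inequality, II: slices of a family and of its difference family at a point

Support file (seat `prim-masterthm-p1`, gen 29; `--supports stmt-CriticalPhenomena-4575`).  No `sorry`, standard axioms.
Memo `run/shared/lean/prim/prim-masterthm/FROM-prim-masterthm-p1-g29-MS-EQUALITY.md` (Setup S).

For a family `Q` and a point `r`: `slice₀ Q r` = members avoiding `r`, `slice₁ Q r` = members containing `r` with `r` erased;
`P = slice₀ ∪ slice₁`, `T = slice₀ ∩ slice₁` (families on the ground set minus `r`).  This is the Ahlswede–Daykin / Marica–Schönheim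
induction step written as IDENTITIES:
* `#Q = #slice₀ + #slice₁` (`card_eq_card_slice₀_add_card_slice₁`), hence `#Q = #P + #T`;
* `slice₀ (Q \\ Q) r = (slice₀ \\ P) ∪ (slice₁ \\ slice₁)` and `slice₁ (Q \\ Q) r = slice₁ \\ slice₀` (`slice₀_diffs`, `slice₁_diffs`);
* the two slices of `Q \\ Q` cover `P \\ P` and both contain `T \\ T`;
* consequently (`slices_of_card_diffs_eq`) **if `#(Q \\ Q) = #Q` then `#(P \\ P) = #P`, `#(T \\ T) = #T`, and the two slices of `Q \\ Q` meet
  EXACTLY in `T \\ T`** — the three conditions the characterisation of equality (files `…SahiMSNested`, `…SahiMSRigid`, `…SahiMSEquality`)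
  feeds on.  Independent of `…SahiMSWitness`. [this work]
-/

namespace Summit.CriticalPhenomena.PercolationContinuityZ3.Theorems.SahiMSEquality

open Finset
open scoped FinsetFamily

variable {α : Type*} [DecidableEq α]

/-! ### 4. Slices of a family at a point -/

section Slices

variable (Q : Finset (Finset α)) (r : α)

/-- The members of `Q` NOT containing `r`. [this work] -/
def slice₀ : Finset (Finset α) := Q.filter fun C => r ∉ C

/-- The members of `Q` containing `r`, with `r` erased. [this work] -/
def slice₁ : Finset (Finset α) := (Q.filter fun C => r ∈ C).image fun C => C.erase r

variable {Q r}

/-- Membership in `slice₀`. [this work] -/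
theorem mem_slice₀ {C : Finset α} : C ∈ slice₀ Q r ↔ C ∈ Q ∧ r ∉ C := by
  unfold slice₀; rw [mem_filter]

/-- Membership in `slice₁`. [this work] -/
theorem mem_slice₁ {C : Finset α} : C ∈ slice₁ Q r ↔ r ∉ C ∧ insert r C ∈ Q := by
  unfold slice₁
  rw [mem_image]
  constructor
  · rintro ⟨A, hA, rfl⟩
    obtain ⟨hAQ, hrA⟩ := mem_filter.1 hA
    exact ⟨notMem_erase r A, by rw [insert_erase hrA]; exact hAQ⟩
  · rintro ⟨hrC, hC⟩
    exact ⟨insert r C, mem_filter.2 ⟨hC, mem_insert_self r C⟩, erase_insert hrC⟩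

/-- Members of the slices avoid `r`. [this work] -/
theorem not_mem_of_mem_slice {C : Finset α} (h : C ∈ slice₀ Q r ∪ slice₁ Q r) : r ∉ C := by
  rcases mem_union.1 h with h | h
  · exact (mem_slice₀.1 h).2
  · exact (mem_slice₁.1 h).1

/-- `#Q = #slice₀ + #slice₁`. [this work] -/
theorem card_eq_card_slice₀_add_card_slice₁ (Q : Finset (Finset α)) (r : α) : #Q = #(slice₀ Q r) + #(slice₁ Q r) := by
  unfold slice₀ slice₁
  rw [card_image_of_injOn, add_comm]
  · exact (card_filter_add_card_filter_not _).symm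
  · intro A hA B hB h
    have hrA : r ∈ A := (mem_filter.1 (mem_coe.1 hA)).2
    have hrB : r ∈ B := (mem_filter.1 (mem_coe.1 hB)).2
    simp only at h
    rw [← insert_erase hrA, ← insert_erase hrB, h]

/-- If all members of `Q` lie in `F` then all members of the slices lie in `F.erase r`. [this work] -/
theorem subset_erase_of_mem_slice {F : Finset α} (hQF : ∀ C ∈ Q, C ⊆ F) {C : Finset α}
    (h : C ∈ slice₀ Q r ∪ slice₁ Q r) : C ⊆ F.erase r := by
  intro x hx
  rcases mem_union.1 h with h' | h'
  · obtain ⟨hCQ, hrC⟩ := mem_slice₀.1 h'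
    exact mem_erase.2 ⟨fun e => hrC (e ▸ hx), hQF C hCQ hx⟩
  · obtain ⟨hrC, hC⟩ := mem_slice₁.1 h'
    exact mem_erase.2 ⟨fun e => hrC (e ▸ hx), hQF _ hC (mem_insert_of_mem hx)⟩

/-- For `r ∈ A`: `A.erase r ∈ slice₁ Q r` iff `A ∈ Q`. [this work] -/
theorem erase_mem_slice₁ {A : Finset α} (hrA : r ∈ A) (hA : A ∈ Q) : A.erase r ∈ slice₁ Q r :=
  mem_slice₁.2 ⟨notMem_erase r A, by rw [insert_erase hrA]; exact hA⟩

/-- **Slices of the difference family, level 0**: the differences avoiding `r` are the differences `a \ p` (`a ∈ slice₀`,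
`p` in either slice) together with the differences inside `slice₁`. [this work] -/
theorem slice₀_diffs (Q : Finset (Finset α)) (r : α) :
    slice₀ (Q \\ Q) r = (slice₀ Q r \\ (slice₀ Q r ∪ slice₁ Q r)) ∪ (slice₁ Q r \\ slice₁ Q r) := by
  ext X
  constructor
  · intro hX
    obtain ⟨hXQ, hrX⟩ := mem_slice₀.1 hX
    obtain ⟨A, hA, B, hB, rfl⟩ := mem_diffs.1 hXQ
    by_cases hrA : r ∈ A
    · have hrB : r ∈ B := by
        by_contra hrB; exact hrX (mem_sdiff.2 ⟨hrA, hrB⟩)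
      refine mem_union.2 (Or.inr (mem_diffs.2 ⟨A.erase r, erase_mem_slice₁ hrA hA, B.erase r, erase_mem_slice₁ hrB hB, ?_⟩))
      ext x; simp only [mem_sdiff, mem_erase]
      constructor
      · rintro ⟨⟨hxr, hxA⟩, hx⟩; exact ⟨hxA, fun hxB => hx ⟨hxr, hxB⟩⟩
      · rintro ⟨hxA, hxB⟩; exact ⟨⟨fun e => hxB (e ▸ hrB), hxA⟩, fun h => hxB h.2⟩
    · refine mem_union.2 (Or.inl (mem_diffs.2 ⟨A, mem_slice₀.2 ⟨hA, hrA⟩, ?_⟩))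
      by_cases hrB : r ∈ B
      · refine ⟨B.erase r, mem_union.2 (Or.inr (erase_mem_slice₁ hrB hB)), ?_⟩
        ext x; simp only [mem_sdiff, mem_erase]
        constructor
        · rintro ⟨hxA, hx⟩; exact ⟨hxA, fun hxB => hx ⟨fun e => hrA (e ▸ hxA), hxB⟩⟩
        · rintro ⟨hxA, hxB⟩; exact ⟨hxA, fun h => hxB h.2⟩
      · exact ⟨B, mem_union.2 (Or.inl (mem_slice₀.2 ⟨hB, hrB⟩)), rfl⟩
  · intro hX
    rcases mem_union.1 hX with hX | hX
    · obtain ⟨A, hA, B, hB, rfl⟩ := mem_diffs.1 hX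
      obtain ⟨hAQ, hrA⟩ := mem_slice₀.1 hA
      refine mem_slice₀.2 ⟨?_, fun h => hrA (mem_sdiff.1 h).1⟩
      rcases mem_union.1 hB with hB | hB
      · exact sdiff_mem_diffs hAQ (mem_slice₀.1 hB).1
      · obtain ⟨_, hBQ⟩ := mem_slice₁.1 hB
        have e : A \ B = A \ insert r B := by
          ext x; simp only [mem_sdiff, mem_insert]
          constructor
          · rintro ⟨hxA, hxB⟩; exact ⟨hxA, fun h => h.elim (fun e => hrA (e ▸ hxA)) hxB⟩
          · rintro ⟨hxA, hx⟩; exact ⟨hxA, fun hxB => hx (Or.inr hxB)⟩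
        rw [e]; exact sdiff_mem_diffs hAQ hBQ
    · obtain ⟨A, hA, B, hB, rfl⟩ := mem_diffs.1 hX
      obtain ⟨hrA, hAQ⟩ := mem_slice₁.1 hA
      obtain ⟨_, hBQ⟩ := mem_slice₁.1 hB
      refine mem_slice₀.2 ⟨?_, fun h => hrA (mem_sdiff.1 h).1⟩
      have e : A \ B = insert r A \ insert r B := by
        ext x; simp only [mem_sdiff, mem_insert]
        constructor
        · rintro ⟨hxA, hxB⟩; exact ⟨Or.inr hxA, fun h => h.elim (fun e => hrA (e ▸ hxA)) hxB⟩
        · rintro ⟨hxA, hx⟩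
          rcases hxA with rfl | hxA
          · exact absurd (Or.inl rfl) hx
          · exact ⟨hxA, fun hxB => hx (Or.inr hxB)⟩
      rw [e]; exact sdiff_mem_diffs hAQ hBQ

/-- **Slices of the difference family, level 1**: the differences containing `r` (with `r` erased) are `slice₁ \\ slice₀`. [this work] -/
theorem slice₁_diffs (Q : Finset (Finset α)) (r : α) : slice₁ (Q \\ Q) r = slice₁ Q r \\ slice₀ Q r := by
  ext X
  constructor
  · intro hX
    obtain ⟨hrX, hXQ⟩ := mem_slice₁.1 hX
    obtain ⟨A, hA, B, hB, hAB⟩ := mem_diffs.1 hXQ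
    have hr : r ∈ A \ B := hAB ▸ mem_insert_self r X
    obtain ⟨hrA, hrB⟩ := mem_sdiff.1 hr
    refine mem_diffs.2 ⟨A.erase r, erase_mem_slice₁ hrA hA, B, mem_slice₀.2 ⟨hB, hrB⟩, ?_⟩
    have hx : ∀ x, x ∈ insert r X ↔ x ∈ A ∧ x ∉ B := fun x => by rw [← hAB, mem_sdiff]
    ext x; simp only [mem_sdiff, mem_erase]
    constructor
    · rintro ⟨⟨hxr, hxA⟩, hxB⟩; exact (mem_insert.1 ((hx x).2 ⟨hxA, hxB⟩)).resolve_left hxr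
    · intro hxX
      obtain ⟨hxA, hxB⟩ := (hx x).1 (mem_insert_of_mem hxX)
      exact ⟨⟨fun e => hrX (e ▸ hxX), hxA⟩, hxB⟩
  · intro hX
    obtain ⟨A, hA, B, hB, rfl⟩ := mem_diffs.1 hX
    obtain ⟨hrA, hAQ⟩ := mem_slice₁.1 hA
    obtain ⟨hBQ, hrB⟩ := mem_slice₀.1 hB
    refine mem_slice₁.2 ⟨fun h => hrA (mem_sdiff.1 h).1, ?_⟩
    have e : insert r (A \ B) = insert r A \ B := by
      ext x; simp only [mem_sdiff, mem_insert]
      constructor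
      · rintro (rfl | ⟨hxA, hxB⟩)
        · exact ⟨Or.inl rfl, hrB⟩
        · exact ⟨Or.inr hxA, hxB⟩
      · rintro ⟨hxA, hxB⟩
        rcases hxA with rfl | hxA
        · exact Or.inl rfl
        · exact Or.inr ⟨hxA, hxB⟩
    rw [e]; exact sdiff_mem_diffs hAQ hBQ

/-- The two slices of the difference family cover exactly the difference family of `P = slice₀ ∪ slice₁`. [this work] -/
theorem slice₀_diffs_union_slice₁_diffs (Q : Finset (Finset α)) (r : α) :
    slice₀ (Q \\ Q) r ∪ slice₁ (Q \\ Q) r = (slice₀ Q r ∪ slice₁ Q r) \\ (slice₀ Q r ∪ slice₁ Q r) := by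
  rw [slice₀_diffs, slice₁_diffs, diffs_union_left, diffs_union_right, diffs_union_right]
  ext X; simp only [mem_union]; tauto

/-- The difference family of `T = slice₀ ∩ slice₁` lies in both slices of the difference family. [this work] -/
theorem diffs_inter_subset (Q : Finset (Finset α)) (r : α) :
    (slice₀ Q r ∩ slice₁ Q r) \\ (slice₀ Q r ∩ slice₁ Q r) ⊆ slice₀ (Q \\ Q) r ∩ slice₁ (Q \\ Q) r := by
  rw [slice₀_diffs, slice₁_diffs]
  intro X hX
  refine mem_inter.2 ⟨mem_union.2 (Or.inr ?_), ?_⟩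
  · exact diffs_subset inter_subset_right inter_subset_right hX
  · exact diffs_subset inter_subset_right inter_subset_left hX

/-- **Equality propagates to the slices.**  If `#(Q \\ Q) = #Q` then `P = slice₀ ∪ slice₁` and `T = slice₀ ∩ slice₁` attain equality
too, and the two slices of `Q \\ Q` meet exactly in `T \\ T`. [this work] -/
theorem slices_of_card_diffs_eq (Q : Finset (Finset α)) (r : α) (hQ : #(Q \\ Q) = #Q) :
    #((slice₀ Q r ∪ slice₁ Q r) \\ (slice₀ Q r ∪ slice₁ Q r)) = #(slice₀ Q r ∪ slice₁ Q r) ∧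
    #((slice₀ Q r ∩ slice₁ Q r) \\ (slice₀ Q r ∩ slice₁ Q r)) = #(slice₀ Q r ∩ slice₁ Q r) ∧
    slice₀ (Q \\ Q) r ∩ slice₁ (Q \\ Q) r = (slice₀ Q r ∩ slice₁ Q r) \\ (slice₀ Q r ∩ slice₁ Q r) := by
  set s₀ := slice₀ Q r
  set s₁ := slice₁ Q r
  set A := slice₀ (Q \\ Q) r
  set B := slice₁ (Q \\ Q) r
  have h1 : #(Q \\ Q) = #A + #B := card_eq_card_slice₀_add_card_slice₁ _ r
  have h2 : #Q = #s₀ + #s₁ := card_eq_card_slice₀_add_card_slice₁ _ r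
  have h3 : #A + #B = #(A ∪ B) + #(A ∩ B) := (card_union_add_card_inter A B).symm
  have h4 : #s₀ + #s₁ = #(s₀ ∪ s₁) + #(s₀ ∩ s₁) := (card_union_add_card_inter s₀ s₁).symm
  have h5 : A ∪ B = (s₀ ∪ s₁) \\ (s₀ ∪ s₁) := slice₀_diffs_union_slice₁_diffs Q r
  have h6 : (s₀ ∩ s₁) \\ (s₀ ∩ s₁) ⊆ A ∩ B := diffs_inter_subset Q r
  have hP : #(s₀ ∪ s₁) ≤ #((s₀ ∪ s₁) \\ (s₀ ∪ s₁)) := Finset.card_le_card_diffs _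
  have hT : #(s₀ ∩ s₁) ≤ #((s₀ ∩ s₁) \\ (s₀ ∩ s₁)) := Finset.card_le_card_diffs _
  have h6' : #((s₀ ∩ s₁) \\ (s₀ ∩ s₁)) ≤ #(A ∩ B) := card_le_card h6
  rw [h5] at h3
  have hPe : #((s₀ ∪ s₁) \\ (s₀ ∪ s₁)) = #(s₀ ∪ s₁) := by omega
  have hTe : #((s₀ ∩ s₁) \\ (s₀ ∩ s₁)) = #(s₀ ∩ s₁) := by omega
  refine ⟨hPe, hTe, ?_⟩
  symm
  apply eq_of_subset_of_card_le h6
  omega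

end Slices

end Summit.CriticalPhenomena.PercolationContinuityZ3.Theorems.SahiMSEquality
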